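import Mathlib
import Summits.NavierStokesRegularity.NavierStokesRegularity.Theorems.BarrierStepRungThreeCertificateProfileKit
import Summits.NavierStokesRegularity.NavierStokesRegularity.Theorems.BarrierStepRungThreeWindowBoxReduction
import HarnessLib

/-!
# The certificate TEMPLATE of the repaired line (route `BarrierStepRungThree`): rung TL-M3 from a
  finite list of numeric side conditions and polynomial box clauses

Supports items stmt-NavierStokesRegularity-23420 / 23648 / 23942.  This file composes

* the PROFILE KIT (`CertificateProfile.certificateProfileKit`, files `…CertificateProfileAbove/Below/
  Slack/Kit.lean`): an outside profile `(r, q, ρ)`, envelope `env` and slack majorant `Ψ` with the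
  sequence clauses 14–18, 20, the envelope part of 19, the TAIL RATE clause 26 and the outside conjunct
  of the GOAL clause 27 of the repaired certificate format, from finitely many numeric conditions;
* ns-bsr3-p5's box reduction and free margin split (`WindowBox.region_bounds`,
  `WindowBox.decrease_of_box_le`, `taoLadderRungThree_target_of_windowCertificateMarginSplit₃`);
* ns-bsr3-p1's soundness theorem `barrierSoundness₃` behind them,

into ONE theorem, `taoLadderRungThree_target_of_boxCertificateKit`, whose hypotheses are exactly what
the writer of the one rational certificate must check: the table (`InTableClass R α`, datum mode), the
exponents and constants, a `C¹` clock `v` and continuous goal `g` on `ℝ^{4n}` (for polynomial ones use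
`WindowCertificateMargin.polyEval_contDiff` / `SOSPolyCalculus`), the kit's NUMERIC side conditions
(`hz`, `hG8`, `hlamG`, `hgoal0`, `hT1`, `hT2`), the window-cap inequalities `hcap` (clause 19 with the
explicit slack bound `c 2^{-kLo} W`), the absorption budget, and FIVE statements about `v, g` on the
finite-dimensional BOX — datum, properness, clock floor, gradient bound, and the two box clauses
`hdec` (undisturbed decrease `≤ -(γ+δ)`) and `hgoal` (goal ⇒ window re-entry) in which the two boundary
shells enter only through the explicit caps `|S_{·,kLo-1}| ≤ Q_b G` and
`|S_{·,kLo+n}| ≤ 2cA₁ 2^{5(K-1)/2} q_top²`.  No `ℤ`-indexed sequence, no energy variable `F`, no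
quantifier over lattice states outside the window and its two neighbours remains.

HONEST FRAMING: an implication about Tao-type MODEL lattice pseudo-flows (rung TL-M3 of the Tao
ladder, not the summit Statement); NO certificate is produced here — the box clauses for SOME
comparable table are the line's open ∃-crux; nothing in this file is a statement about the
Navier–Stokes equations and NS regularity is not proved by any of this.
-/

noncomputable section

-- the sub-problem namespace repeats the summit name by design (D-0017)
set_option linter.dupNamespace false

namespace Summit.NavierStokesRegularity.NavierStokesRegularity.Theorems

open Literature.Analysis.FluidPDE Literature.Analysis.FluidPDE.TaoCascade

/-- **Rung TL-M3 from a BOX certificate with the profile kit (repaired format K2″, free margin split).**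
Data: spread `R`, exponents `θ ∈ [0, 1/2]`, clock `c`, defect margin `η`, rate `γ`, split `δ`, gradient
bound `Λ`, datum mode `i₀`, table `α`, datum `X₀`, window `[kLo, kLo+n)` (`kLo ≤ 0 < 2 ≤ kLo + n`),
clock/barrier `v` and goal `g` on `ℝ^{4×n}`, properness bounds `Mw`, window caps `Φ` with bounds
`E_w, E₀, q_top`, coefficient sums `A₀, Aₓ, A₁` of the table, lower-profile numbers `Q_b, G, λ`.
Hypotheses: the numeric side conditions of `CertificateProfile.certificateProfileKit`; the window-cap
clause with the explicit slack bound (`hcap`); the absorption budget `Λ η 4^{kLo+j} √Φ_ij ≤ δ`; and the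
box clauses — datum, properness, floor, gradient bound, undisturbed decrease `≤ -(γ+δ)` on the box,
goal ⇒ window re-entry on the box (boundary shells through the explicit caps).  Conclusion:
`TaoLadderRungThree.Target`.  [cite: Tao2016AveragedNS, §6.4 Prop. 6.5 with §6.1–6.2 and §4
(4.5)–(4.10); PrajnaRantzer2007 Thm 3.5 and §3.4 (robust eventuality certificates)] -/
theorem taoLadderRungThree_target_of_boxCertificateKit
    {R θ c η γ δ Λ : ℝ} {i₀ : Fin 4} {α : Fin 4 → Fin 4 → Fin 4 → ℤ × ℤ × ℤ → ℝ} {X₀ : Fin 4 → ℝ}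
    {n : ℕ} {kLo : ℤ} {v g : (Fin 4 → Fin n → ℝ) → ℝ} {Mw Φ : Fin 4 → Fin n → ℝ}
    {A₀ Aₓ A₁ E_w E₀ q_top Q_b G lam : ℝ}
    -- table, exponents, constants
    (hR : 1 ≤ R) (hα : InTableClass R α) (hX₀ : X₀ i₀ ≠ 0) (hθ0 : 0 ≤ θ) (hθ : θ ≤ 1 / 2)
    (hc : 0 < c) (hη : 0 < η) (hγ : 0 < γ) (hkLo : kLo ≤ 0) (hkn : (2 : ℤ) ≤ kLo + n)
    (hv : ContDiff ℝ 1 v) (hg : Continuous g)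
    -- the profile kit's numeric side conditions
    (hA₀ : ∀ i, (∑ i₁ : Fin 4, ∑ i₂ : Fin 4, |α i₁ i₂ i (0, 0, 0)|) ≤ A₀)
    (hAₓ : ∀ i, (∑ i₁ : Fin 4, ∑ i₂ : Fin 4, |α i₁ i₂ i (1, 0, 0)|) +
      (∑ i₁ : Fin 4, ∑ i₂ : Fin 4, |α i₁ i₂ i (0, 1, 0)|) ≤ Aₓ)
    (hA₁i : ∀ i, (∑ i₁ : Fin 4, ∑ i₂ : Fin 4, |α i₁ i₂ i (0, 0, 1)|) ≤ A₁) (hA₁ : 0 < A₁)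
    (hA₁s : (∑ i₁ : Fin 4, ∑ i₂ : Fin 4, ∑ i₃ : Fin 4, |α i₁ i₂ i₃ (0, 0, 1)|) ≤ A₁)
    (hΦ0 : ∀ i j, 0 ≤ Φ i j) (hΦw : ∀ i j, Φ i j ≤ E_w) (hE₀ : 0 ≤ E₀)
    (hΦ₀ : ∀ (i : Fin 4) (j : Fin n), (j : ℕ) = 0 → Φ i j ≤ E₀) (hqt : 0 < q_top)
    (hΦtop : ∀ (i : Fin 4) (j : Fin n), (j : ℕ) + 1 = n → 2 * Φ i j ≤ q_top ^ 2)
    (hz : 2 * c * A₁ * (2 : ℝ) ^ ((5 : ℝ) * ((kLo + n : ℤ) : ℝ) / 2) * q_top ≤ 1 / 2)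
    (hQb : 0 < Q_b) (hG : 0 < G) (hG8 : G ^ 2 < 8) (hlam : lam < 1) (hlamG : (2 : ℝ) ^ θ ≤ lam * G)
    (hgoal0 : (2 : ℝ) ^ (2 * θ) * (2 * E₀) ≤ (lam * Q_b * G) ^ 2)
    (hT1 : c * ((2 : ℝ) ^ ((5 : ℝ) * ((kLo - 1 : ℤ) : ℝ) / 2) *
        (A₀ * (Q_b * G) ^ 2 + Aₓ * (Q_b * G) * Real.sqrt (2 * E₀)) +
        (2 : ℝ) ^ ((5 : ℝ) * ((kLo - 2 : ℤ) : ℝ) / 2) * (A₁ * (Q_b * G ^ 2) ^ 2)) ≤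
        (1 - lam) * (Q_b * G))
    (hT2 : c * Q_b * (2 : ℝ) ^ ((5 : ℝ) * (kLo : ℝ) / 2) * (G * (2 : ℝ) ^ (-(5 : ℝ) / 2)) ^ 2 *
        (A₀ + Aₓ / G + A₁ * G ^ 2 * (2 : ℝ) ^ (-(5 : ℝ) / 2)) ≤ 1 - lam)
    -- clause 19 with the explicit slack bound, and the absorption budget (split δ)
    (hcap : ∀ (i : Fin 4) (j : Fin n), Mw i j ^ 2 / 2 +
      η * (c * (2 : ℝ) ^ (-(kLo : ℝ)) *
        (Q_b ^ 2 / 2 * (2 : ℝ) ^ ((3 : ℝ) * (kLo : ℝ)) * (8 / (8 - G ^ 2)) +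
          n * (2 : ℝ) ^ ((3 : ℝ) * (((kLo + n : ℤ) : ℝ) - 1)) * (E_w + q_top ^ 2 / 2) +
          4 / 3 * (2 : ℝ) ^ (-(2 : ℝ) * ((kLo + n : ℤ) : ℝ)) / (2 * c * A₁) ^ 2)) +
      η * (1 + 1 : ℝ) ^ ((2 : ℝ) * ((kLo + (j : ℕ) : ℤ) : ℝ)) * c * Φ i j < Φ i j)
    (hΛ : ∀ x : Fin 4 → Fin n → ℝ, v x ≤ 0 → ‖fderiv ℝ v x‖ ≤ Λ) (hΛ0 : 0 ≤ Λ)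
    (hbudget : ∀ (i : Fin 4) (j : Fin n),
      Λ * (η * (1 + 1 : ℝ) ^ ((2 : ℝ) * ((kLo + (j : ℕ) : ℤ) : ℝ)) * Real.sqrt (Φ i j)) ≤ δ)
    -- the box clauses about (v, g)
    (hv0 : v (fun i (j : Fin n) => datumState i₀ X₀ i (kLo + (j : ℕ))) ≤ 0)
    (hg0 : 0 < g (fun i (j : Fin n) => datumState i₀ X₀ i (kLo + (j : ℕ))))
    (hproper : ∀ x : Fin 4 → Fin n → ℝ, v x ≤ 0 → ∀ i j, |x i j| ≤ Mw i j)
    (hfloor : ∀ x : Fin 4 → Fin n → ℝ, v x ≤ 0 → 0 < g x → -(γ * c) < v x)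
    (hdec : ∀ S : Fin 4 → ℤ → ℝ, v (fun i (j : Fin n) => S i (kLo + (j : ℕ))) ≤ 0 →
      (∀ i : Fin 4, |S i (kLo - 1)| ≤ Q_b * G) →
      (∀ i : Fin 4, |S i (kLo + n)| ≤
        2 * c * A₁ * (2 : ℝ) ^ ((5 : ℝ) * ((kLo + n - 1 : ℤ) : ℝ) / 2) * q_top ^ 2) →
      (∀ (i : Fin 4) (j : Fin n), S i (kLo + (j : ℕ)) ^ 2 ≤ 2 * Φ i j) →
      0 < g (fun i (j : Fin n) => S i (kLo + (j : ℕ))) →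
      (fderiv ℝ v (fun i (j : Fin n) => S i (kLo + (j : ℕ))))
        (fun i (j : Fin n) => quadTerm 1 α (fun i' k' (_ : ℝ) => S i' k') i (kLo + (j : ℕ)) 0) ≤
        -(γ + δ))
    (hgoal : ∀ S : Fin 4 → ℤ → ℝ, v (fun i (j : Fin n) => S i (kLo + (j : ℕ))) ≤ 0 →
      (∀ i : Fin 4, |S i (kLo - 1)| ≤ Q_b * G) →
      (∀ i : Fin 4, |S i (kLo + n)| ≤
        2 * c * A₁ * (2 : ℝ) ^ ((5 : ℝ) * ((kLo + n - 1 : ℤ) : ℝ) / 2) * q_top ^ 2) →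
      (∀ (i : Fin 4) (j : Fin n), S i (kLo + (j : ℕ)) ^ 2 ≤ 2 * Φ i j) →
      g (fun i (j : Fin n) => S i (kLo + (j : ℕ))) ≤ 0 →
      (1 + 1 : ℝ) ^ (-θ) ≤ |S i₀ 1| ∧
        v (fun i (j : Fin n) => S i (1 + (kLo + (j : ℕ))) / |S i₀ 1|) ≤ 0 ∧
        0 < g (fun i (j : Fin n) => S i (1 + (kLo + (j : ℕ))) / |S i₀ 1|)) :
    Summit.NavierStokesRegularity.NavierStokesRegularity.Theses.TaoLadderRungThree.Target := by
  obtain ⟨r, q, ρ, env, Ψ, h14, h15, h16, h17, h18, h19e, hΨB, h20, hqlo, hqhi, hqpos, h26, h27o⟩ :=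
    CertificateProfile.certificateProfileKit θ c n kLo α Φ A₀ Aₓ A₁ E_w E₀ q_top Q_b G lam hθ hc hkLo
      hkn hA₀ hAₓ hA₁i hA₁ hA₁s hΦ0 hΦw hE₀ hΦ₀ hqt hΦtop hz hQb hG hG8 hlam hlamG hgoal0 hT1 hT2
  have hq0 : ∀ k, 0 ≤ q k := fun k => (hqpos k).le
  -- boundary caps from the profile
  have hbd : ∀ S : Fin 4 → ℤ → ℝ, (∀ (i : Fin 4) (k : ℤ), (k < kLo ∨ kLo + n ≤ k) → |S i k| ≤ q k) →
      (∀ i : Fin 4, |S i (kLo - 1)| ≤ Q_b * G) ∧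
      (∀ i : Fin 4, |S i (kLo + n)| ≤
        2 * c * A₁ * (2 : ℝ) ^ ((5 : ℝ) * ((kLo + n - 1 : ℤ) : ℝ) / 2) * q_top ^ 2) := by
    intro S hout
    refine ⟨fun i => ?_, fun i => ?_⟩
    · have := hout i (kLo - 1) (Or.inl (by omega)); rwa [hqlo] at this
    · have := hout i (kLo + n) (Or.inr le_rfl); rwa [hqhi] at this
  -- clause 19
  have h19 : ∀ (i : Fin 4) (j : Fin n), 0 ≤ Φ i j ∧ Φ i j ≤ env (kLo + (j : ℕ)) ∧
      Mw i j ^ 2 / 2 + η * Ψ (kLo + (j : ℕ)) +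
        η * (1 + 1 : ℝ) ^ ((2 : ℝ) * ((kLo + (j : ℕ) : ℤ) : ℝ)) * c * Φ i j < Φ i j := by
    intro i j
    refine ⟨hΦ0 i j, h19e i j, ?_⟩
    have h1 := mul_le_mul_of_nonneg_left (hΨB j) hη.le
    have h2 := hcap i j
    linarith
  -- the decrease clause in box form with the profile caps
  have hdec' : ∀ S : Fin 4 → ℤ → ℝ, v (fun i (j : Fin n) => S i (kLo + (j : ℕ))) ≤ 0 →
      (∀ (i : Fin 4) (k : ℤ), (k < kLo ∨ kLo + n ≤ k) → |S i k| ≤ q k) →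
      (∀ (i : Fin 4) (j : Fin n), S i (kLo + (j : ℕ)) ^ 2 ≤ 2 * Φ i j) →
      0 < g (fun i (j : Fin n) => S i (kLo + (j : ℕ))) →
      (fderiv ℝ v (fun i (j : Fin n) => S i (kLo + (j : ℕ))))
        (fun i (j : Fin n) => quadTerm 1 α (fun i' k' (_ : ℝ) => S i' k') i (kLo + (j : ℕ)) 0) ≤
        -(γ + δ) :=
    fun S hvS hout hbox hgS => hdec S hvS (hbd S hout).1 (hbd S hout).2 hbox hgS
  refine taoLadderRungThree_target_of_windowCertificateMarginSplit₃
    ⟨R, θ, c, η, γ, i₀, α, X₀, n, kLo, v, g, r, q, ρ, env, Ψ, Mw, Φ,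
      (fun S i (j : Fin n) => S i (kLo + (j : ℕ))),
      (fun S i k => quadTerm 1 α (fun i' k' (_ : ℝ) => S i' k') i k 0), Λ, δ,
      hR, hα, hX₀, hθ0, hθ, hc, hη, hγ, hkLo, hkn, fun _ _ _ => rfl, fun _ _ _ => rfl, hv, hg, h14,
      h15, h16, h17, h18, h19, h20, hv0, hg0, hproper, hfloor,
      WindowBox.decrease_of_box_le (kLo := kLo) hq0 hdec', hΛ, hΛ0, hbudget, ?_, ?_⟩
  · -- clause 26: tail rate below the window (profile kit)
    intro S F hreg i k hk
    exact h26 S F hreg.2.1 hreg.2.2.2.1 hreg.2.2.2.2 i k hk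
  · -- clause 27: goal ⇒ re-entry (window part on the box, outside part from the kit)
    intro S F hreg hgS
    obtain ⟨hvS, hSF, -, hout, hwin⟩ := hreg
    obtain ⟨hb1, hb2⟩ := WindowBox.region_bounds (kLo := kLo) hq0 hSF hout hwin
    obtain ⟨ha, hv', hg'⟩ := hgoal S hvS (hbd S hb1).1 (hbd S hb1).2 hb2 hgS
    exact ⟨ha, hv', hg', h27o F hout hwin |S i₀ 1| ha⟩

end Summit.NavierStokesRegularity.NavierStokesRegularity.Theorems

end
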